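import Summits.QuantumFields.BalabanUV.Beta.RelInvSymBorderedHessianStep
import Summits.QuantumFields.BalabanUV.Beta.SymSliceProjectorSpread
import Summits.QuantumFields.BalabanUV.Beta.SymmetrisedStepJets

/-!
# `BalabanUV.Beta.RelInvNullShift` — binder row D1, RULING R-D1-g28-1: THE RELATIVE INVERSE IS STABLE UNDER `E`-NULL SHIFTS OF THE SPREAD
# (`RelInv A M E ∧ E∘D∘E = 0 ⟹ RelInv A (M + D) E`), and the instance for the (0.4) literal: `RelInv (Gsym j) (bhKStep j + c • D) (symEc Lc)` ∀ j
# for every `symEc`-null spread `D` — the transfer of K3-b `relInv_coDressKSymAt_KInvStep_bhKStep` to the SHIFTED STRAIGHT spread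

HONEST FRAMING (cell charter, verbatim): «discharging BetaPertH makes Balaban's UV stability UNCONDITIONAL — a real constructive-QFT result; it is
NOT the continuum limit and NOT the Clay problem.»  HONEST DEPENDENCY: continuum YM on T⁴ ⇐ BetaPertH ∧ nine spine estimates (0/9 proved);
BetaPertH ⇐ (D1) ∧ (D4) ∧ CAP+tail; G-an2-4 gates asym, D1 and NE2/3/4.
DERIVED cell leaf (β sub-cell, BINDER-OWNERS row D1 OWNER `b2b-balaban-beta-an2`, gen 28).  WHY (X-an2-55, an1-g36's exact line over the fifteen
(0.4)-twin numerator files): the first-order border table of the symmetrised literal obeys its pointwise Ward law against the SYMMETRISED-rooted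
bordered Hessian `bhKSym = bhK + Dsh`, whose shift `Dsh` off the straight `bhK` is `symEc`-NULL (its field leg lies in `(ker Gmat)^⊥` on interior
bonds and vanishes on face-crossing bonds); the row's relative-inverse socket K3-b is proved for the STRAIGHT `bhKStep`.  This file is the 20-line
observation that no new socket is needed: the four relative rules survive any shift `D` of the spread with `E∘D∘E = 0` (rules 3∕4 through
`A = A∘E = E∘A` and tame associativity) — exactly the pattern of the comb's `BorderedHessianRooted.relInv_of_combSupported_sub` (there `E = axEc ρ`,
`D` comb-supported), with the support hypothesis replaced by the sandwich identity.  No statement of Bałaban's papers, no `[cite:]`, no `Prop` fact,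
no `def`.  Discharges NO binder of the row: it re-bases the `RelInv` socket of the (0.4) root to the shifted spread of R-D1-g28-1; root-level classes
0∕5; NOT D1, NOT `BetaPertH`, NOT continuum, NOT Clay.
WHAT ([folklore]): §1 `spr_add`, `spr_smul`, `sandwichNull_smul` (tame bookkeeping); §2 **`relInv_add_of_sandwich_null`**; §3 the instances
**`relInv_coDressKSymAt_KInvStep_bhKStep_add`** (any level, any `symEc`-null `D`, any scalar) and `relInv_Gsym_bhKStep_add` (the literal's `Gsym`).
Provenance: β sub-cell, unit beta-an2 gen 28, 2026-08-21 (v1); over `ChartConjugationRelative` (an2 gen 12), `RelInvSymBorderedHessianStep` (K3-b, an2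
gen 25), `SymSliceProjectorSpread`, `SymmetrisedStepJets` BY NAME; no existing file touched.
-/

open Finset
open scoped BigOperators
open Literature.MathematicalPhysics.QuantumFieldTheory
open Literature.MathematicalPhysics.QuantumFieldTheory.Balaban1983to89
open Literature.MathematicalPhysics.QuantumFieldTheory.Balaban1983to89.Beta
open ExpKernelCalculus (MKer Decays comp)
open OneStepResolventKernel (Fib)
open OneStepKernelFamily (KInvStep)
open AffineAveraging (box toSite)
open AveragingContoursRooted (ctr ctrOff ctrOff_mem_box)
open B12Sec2to5 (l1)
open Summit.QuantumFields.BalabanUV.Beta.TameKernelCalculus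
open Summit.QuantumFields.BalabanUV.Beta.ChartConjugationRelative (RelInv spr_comp)
open Summit.QuantumFields.BalabanUV.Beta.AxialDressingRooted (one_le_of_neZero)
open Summit.QuantumFields.BalabanUV.Beta.BorderedHessian (bhKStep spr_bhKStep)
open Summit.QuantumFields.BalabanUV.Beta.SymmetrisedDressingKernel (coDressKSymAt)
open Summit.QuantumFields.BalabanUV.Beta.SymSliceProjectorKernel (symEc)
open Summit.QuantumFields.BalabanUV.Beta.SymSliceProjectorSpread (spr_symEc)
open Summit.QuantumFields.BalabanUV.Beta.RelInvSymBorderedHessianStep (relInv_coDressKSymAt_KInvStep_bhKStep)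
open Summit.QuantumFields.BalabanUV.Beta.SymmetrisedStepJets (Gsym)

namespace Summit.QuantumFields.BalabanUV.Beta.RelInvNullShift

noncomputable section

/-! ## §1 Tame bookkeeping: sums and scalar multiples of spread kernels; scalar multiples of sandwich-null kernels -/

section Tame

variable {D : ℕ} {F : Type*} [Fintype F]

omit [Fintype F] in
/-- [folklore] The sum of two spread kernels is spread (common rate = the minimum). -/
theorem spr_add {M D' : MKer D F} (hM : Spr M) (hD : Spr D') : Spr (M + D') := by
  obtain ⟨C, δ, hδ, h⟩ := hM
  obtain ⟨C', δ', hδ', h'⟩ := hD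
  refine ⟨|C| + |C'|, min δ δ', lt_min hδ hδ', fun x y a b => ?_⟩
  have h1 := decays_of_le h (min_le_left δ δ') x y a b
  have h2 := decays_of_le h' (min_le_right δ δ') x y a b
  calc |(M + D') x y a b| = |M x y a b + D' x y a b| := rfl
    _ ≤ |M x y a b| + |D' x y a b| := abs_add_le _ _
    _ ≤ _ := by rw [add_mul]; exact add_le_add h1 h2

omit [Fintype F] in
/-- [folklore] A scalar multiple of a spread kernel is spread. -/
theorem spr_smul (c : ℝ) {D' : MKer D F} (hD : Spr D') : Spr (c • D') := by
  obtain ⟨C, δ, hδ, h⟩ := hD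
  refine ⟨|c| * C, δ, hδ, fun x y a b => ?_⟩
  calc |(c • D') x y a b| = |c| * |D' x y a b| := by rw [Pi.smul_apply, Pi.smul_apply, Pi.smul_apply, Pi.smul_apply, smul_eq_mul, abs_mul]
    _ ≤ |c| * (C * Real.exp (-δ * l1 (x - y))) := mul_le_mul_of_nonneg_left (h x y a b) (abs_nonneg c)
    _ = _ := by ring

/-- [folklore] Sandwich-nullity `E∘D∘E = 0` is stable under scalars. -/
theorem sandwichNull_smul (c : ℝ) {E D' : MKer D F} (h : comp (comp E D') E = 0) : comp (comp E (c • D')) E = 0 := by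
  rw [KernelReflection.comp_smul_right, KernelReflection.comp_smul_left, h, smul_zero]

end Tame

/-! ## §2 The relative inverse survives `E`-null shifts of the spread -/

section Shift

variable {D : ℕ} {F : Type*} [Fintype F]

/-- [folklore] **`RelInv A M E ∧ E∘D∘E = 0 ⟹ RelInv A (M + D) E`** (all four kernels spread).  Rules 1∕2 are about `A`, `E` only; rule 3:
`(A∘(M+D))∘E = (A∘M)∘E + (A∘D)∘E = E + ((A∘E)∘D)∘E = E + A∘((E∘D)∘E) = E`; rule 4: `(E∘(M+D))∘A = E + (E∘D)∘(E∘A) = E + ((E∘D)∘E)∘A = E`. -/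
theorem relInv_add_of_sandwich_null {A M E D' : MKer D F} (hA : Spr A) (hM : Spr M) (hE : Spr E) (hD : Spr D') (hR : RelInv A M E)
    (hN : comp (comp E D') E = 0) : RelInv A (M + D') E := by
  obtain ⟨hEA, hAE, h3, h4⟩ := hR
  refine ⟨hEA, hAE, ?_, ?_⟩
  · have e1 : comp A (M + D') = comp A M + comp A D' := comp_add_right_tame hA.tame hM.tame hD.tame
    have e2 : comp (comp A D') E = 0 := by
      calc comp (comp A D') E = comp (comp (comp A E) D') E := by rw [hAE]
        _ = comp (comp A (comp E D')) E := by rw [comp_assoc_tame hA.tame hE.tame hD.tame]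
        _ = comp A (comp (comp E D') E) := (comp_assoc_tame hA.tame (spr_comp hE hD).tame hE.tame).symm
        _ = 0 := by rw [hN, StepDriftWitness.comp_zero_right]
    rw [e1, comp_add_left_tame (spr_comp hA hM).tame (spr_comp hA hD).tame hE.tame, h3, e2, add_zero]
  · have e1 : comp E (M + D') = comp E M + comp E D' := comp_add_right_tame hE.tame hM.tame hD.tame
    have e2 : comp (comp E D') A = 0 := by
      calc comp (comp E D') A = comp (comp E D') (comp E A) := by rw [hEA]
        _ = comp (comp (comp E D') E) A := comp_assoc_tame (spr_comp hE hD).tame hE.tame hA.tame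
        _ = 0 := by rw [hN, KernelWardRelative.comp_zero_left]
    rw [e1, comp_add_left_tame (spr_comp hE hM).tame (spr_comp hE hD).tame hA.tame, h4, e2, add_zero]

/-- [folklore] The scaled form: `RelInv A M E ∧ E∘D∘E = 0 ⟹ RelInv A (M + c • D) E` for every scalar `c`. -/
theorem relInv_add_smul_of_sandwich_null {A M E D' : MKer D F} (hA : Spr A) (hM : Spr M) (hE : Spr E) (hD : Spr D') (hR : RelInv A M E)
    (hN : comp (comp E D') E = 0) (c : ℝ) : RelInv A (M + c • D') E :=
  relInv_add_of_sandwich_null hA hM hE (spr_smul c hD) hR (sandwichNull_smul c hN)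

end Shift

/-! ## §3 The instance for the (0.4) literal: the shifted straight spread at every level -/

section Literal

variable {d : ℕ} {Lc : ℕ} [NeZero Lc]

/-- [folklore] The symmetrised co-dressed step resolvent is spread (it decays: `SymmetrisedStepJets.decays_Gsym`). -/
theorem spr_coDressKSymAt_KInvStep (j : ℕ) : Spr (coDressKSymAt (ctr (d + 1) Lc) Lc (KInvStep (d := d) Lc j)) := by
  obtain ⟨δ, C, hδ, -, h⟩ := SymmetrisedStepJets.decays_Gsym (d := d) Lc j
  exact ⟨C, δ, hδ, h⟩

/-- [folklore] **K3-b TRANSFERRED TO THE SHIFTED STRAIGHT SPREAD** (RULING R-D1-g28-1): for every level `j`, every scalar `c` and every spread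
`symEc`-null kernel `D`, `RelInv (coDressKSymAt ρ_c Lc (KInvStep Lc j)) (bhKStep d Lc j + c • D) (symEc Lc)`. -/
theorem relInv_coDressKSymAt_KInvStep_bhKStep_add (j : ℕ) {D' : MKer (d + 1) (Fib d)} (hD : Spr D')
    (hN : comp (comp (symEc Lc) D') (symEc Lc) = 0) (c : ℝ) :
    RelInv (coDressKSymAt (ctr (d + 1) Lc) Lc (KInvStep (d := d) Lc j)) (bhKStep d Lc j + c • D') (symEc Lc) :=
  relInv_add_smul_of_sandwich_null (spr_coDressKSymAt_KInvStep (d := d) (Lc := Lc) j) (spr_bhKStep (d := d) (Lc := Lc) j)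
    (spr_symEc (one_le_of_neZero Lc)) hD (relInv_coDressKSymAt_KInvStep_bhKStep (d := d) (Lc := Lc) j) hN c

/-- [folklore] The same read on the literal's resolvent name `SymmetrisedStepJets.Gsym Lc j` (`rfl`). -/
theorem relInv_Gsym_bhKStep_add (j : ℕ) {D' : MKer (d + 1) (Fib d)} (hD : Spr D') (hN : comp (comp (symEc Lc) D') (symEc Lc) = 0) (c : ℝ) :
    RelInv (Gsym (d := d) Lc j) (bhKStep d Lc j + c • D') (symEc Lc) :=
  relInv_coDressKSymAt_KInvStep_bhKStep_add (d := d) (Lc := Lc) j hD hN c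

end Literal

end

end Summit.QuantumFields.BalabanUV.Beta.RelInvNullShift
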